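import Summits.QuantumFields.BalabanUV.Beta.GAN24.ConstantBackgroundVolumeLimit

/-!
# `BalabanUV.Beta.GAN24.BackgroundVolumeLimit` — binder row G-an2-4 ∕ (CONV-C), route R7 «TWO CURRENCIES», PART 149: THE BACKGROUND's VOLUME LIMIT IS THE BACKGROUND's POINTWISE LIMIT.
# PART 147's u-derivative END displays ONE input — the pair entry limits (EL₂) of the first-order coupling `P(V_t)^{(k)} = Σ_μ diag(V_t,μ)·∇_μ` at fine integer readings.  Since
# `∇_μ`'s entries at integer pairs are EVENTUALLY the `ℤ^d` stencil (PART 148's `tendsto_fdiff_pair`), that input is EXACTLY the convergence of the background's own values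
# `V_t k μ (ẑ_t, f)` at every fine integer reading (EL₁ of `V_t`): §1 proves EL₂(P(V_t)) ⇐ EL₁(V_t) along ANY volume sequence `side t → ∞`; §2 restates PART 147's END modulo
# EL₁(V_t) only; §3 the class of EVENTUALLY-PULLED-BACK families (`V_t k μ (ẑ_t, f) = v k μ z f` for all large `t` — the samples of ONE `ℤ^d` datum, whatever the family does on
# small volumes or near the seam) has EL₁ for free, so PART 147's END holds for it with NOTHING displayed beyond the volume-uniform Lipschitz letters; PART 148's constant class is
# the sub-case `v k μ z f = v_μ` (unit b2b-balaban-gan24-p3, gen 55; v1)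

NOT IN PRINT; OUR PROOF ([folklore] bookkeeping BY NAME over PART 147 (`conv_effIns_of_background`), PART 148 (`tendsto_fdiff_pair`, `lipschitzBackground_of_const`), NE2's
`FirstOrderBackgroundModel` (`LipschitzBackground`, `Pmodel`, `firstOrder`); [Balaban1987RG1] (1.21)–(1.22) p. 264 LOCATE the shapes; nothing printed is a hypothesis).
HONEST FRAMING (cell contract, verbatim): «discharging `BetaPertH` makes Bałaban's UV stability UNCONDITIONAL — a real constructive-QFT result; it is NOT the
continuum limit and NOT the Clay problem.»  HONEST DEPENDENCY (verbatim): «continuum YM on T⁴ ⇐ BetaPertH ∧ nine spine estimates (0/9 proved); BetaPertH ⇐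
(D1) ∧ (D4) ∧ CAP+tail; G-an2-4 gates asym, D1 and NE2/3/4.»

WHAT THIS FILE PROVES (0 sorry, 0 `def`; `ẑ_t = castT (cubic d (n_k·side t)) z` the fine reading of `z ∈ ℤ^d` at level `k`):
* §1 **`tendsto_Pmodel_pair_of_tendsto`** — along ANY `side t → ∞`: EL₁ of the background at level `k` (`∀ μ f z, ∃ s, V_t k μ (ẑ_t, f) → s`) ⟹ EL₂ of `P(V_t)^{(k)}` at fine integer
  pairs; `tendsto_of_eventually_eq`, `tendsto_background_of_eventually_pullback` (eventually-pulled-back families have EL₁).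
* §2 **`conv_effIns_of_tendsto_background`** — PART 147's END (`d ≥ 3`, `L ≥ 2`, `a > 0`, `μ ≠ ν`, even cubic volumes) for every volume-indexed family of Lipschitz backgrounds (`α, β`
  uniform) DISPLAYING ONLY EL₁ of `V_t`.
* §3 **`conv_effIns_of_eventually_pullback`** — the END with NO limit hypothesis for every Lipschitz family whose readings at each fixed fine integer point are eventually those of one
  `ℤ^d` datum `v` (PART 148's `conv_effIns_constBackground` is the sub-case `v k μ z f = v_μ`; not restated).
WHAT IT DOES NOT DO: construct the torus samples of a given `ℤ^d` connection (the seam clauses of `LipschitzBackground` on small volumes are the user's); `U ≠ 1` beyond first order (PARTs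
151–152); `d ≤ 2`; odd volumes.  SUPPLIER work; NEVER «G-an2-4 closed»; NOT (CONV-C), NOT D1, NOT `BetaPertH`, NOT continuum, NOT Clay.  Records: `HOME/b2b-balaban-gan24-p3/gen55/README.md`.
-/

noncomputable section

open scoped BigOperators ComplexConjugate Matrix Matrix.Norms.L2Operator
open Filter Topology

namespace Summit.QuantumFields.BalabanUV.Beta.GAN24.BackgroundVolumeLimit

open Literature.MathematicalPhysics.QuantumFieldTheory.Balaban1983to89
open Literature.MathematicalPhysics.QuantumFieldTheory.Balaban1983to89.B5Prop11Plancherel (Tor fine fdiff)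
open Literature.MathematicalPhysics.QuantumFieldTheory.Balaban1983to89.B5G183RateUnitTower (lev)
open Literature.MathematicalPhysics.QuantumFieldTheory.Balaban1983to89.B12Sec2to5 (betaPrime510)
open Literature.MathematicalPhysics.QuantumFieldTheory.Balaban1983to89.Beta (Site IsInfiniteVolumeLimit)
open Literature.MathematicalPhysics.QuantumFieldTheory.Balaban1983to89.Beta.FreeLegDictionary (cubic)
open Literature.MathematicalPhysics.QuantumFieldTheory.Balaban1983to89.Beta.BlockKernelVolumeSockets (evenPeriod tendsto_evenPeriod)
open Literature.MathematicalPhysics.QuantumFieldTheory.Balaban1983to89.Beta.VectorTails (castT)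
open Literature.MathematicalPhysics.QuantumFieldTheory.Balaban1983to89.Beta.LimitRate (StepRate limKernelOf KernelInputs)
open Summit.QuantumFields.BalabanUV.T4Continuum
open Summit.QuantumFields.BalabanUV.T4Continuum.CovariantAveragingTower (avgTow)
open Summit.QuantumFields.BalabanUV.T4Continuum.BalabanAveragedTowerUnit (idx QBlev calGlev unitCovB)
open Summit.QuantumFields.BalabanUV.T4Continuum.BalabanAveragedCoerciveTower (unitIdx)
open Summit.QuantumFields.BalabanUV.T4Continuum.FirstOrderBackgroundModel (LipschitzBackground Pmodel firstOrder)
open Summit.QuantumFields.BalabanUV.Beta.GAN24.EffectiveFormInsertionVolumeLimit (conv_effIns_of_background)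
open Summit.QuantumFields.BalabanUV.Beta.GAN24.ConstantBackgroundVolumeLimit (tendsto_fdiff_pair lipschitzBackground_of_const)

variable {d : ℕ} (L : ℕ) [NeZero L]

/-! ## §1 EL₂ of the first-order coupling from EL₁ of the background, along any volume sequence -/

section AnyVolume

variable {side : ℕ → ℕ} [∀ t, NeZero (side t)]

/-- **`tendsto_Pmodel_pair_of_tendsto` — THE COUPLING's PAIR ENTRY LIMITS ARE THE BACKGROUND's POINTWISE LIMITS** [folklore]: along `side t → ∞`, at level `k`, if every reading
`V_t k μ (ẑ_t, f)` of the background at a fixed fine integer point converges (EL₁), then every entry `P(V_t)^{(k)}((ẑ_t,f),(ẑ′_t,g))` converges (EL₂) — the entry is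
`Σ_μ V_t k μ (ẑ_t,f)·(∇^{(k)}_μ)((ẑ_t,f),(ẑ′_t,g))` and the stencil factor is eventually constant (PART 148). -/
theorem tendsto_Pmodel_pair_of_tendsto (hside : Tendsto side atTop atTop) (k : ℕ) (V : (t : ℕ) → (k : ℕ) → Fin d → (idx L (cubic d (side t)) k → ℂ))
    (hV : ∀ (μ f : Fin d) (z : Fin d → ℤ), ∃ s : ℂ, Tendsto (fun t => V t k μ (castT (cubic d (lev L k * side t)) z, f)) atTop (𝓝 s))
    (f g : Fin d) (z z' : Fin d → ℤ) :
    ∃ s : ℂ, Tendsto (fun t => Pmodel L (cubic d (side t)) (V t) k (castT (cubic d (lev L k * side t)) z, f) (castT (cubic d (lev L k * side t)) z', g)) atTop (𝓝 s) := by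
  have hside' : Tendsto (fun t => lev L k * side t) atTop atTop :=
    Filter.Tendsto.const_mul_atTop' (Nat.pos_of_ne_zero (NeZero.ne (lev L k))) hside |>.congr fun t => by ring
  choose sV hsV using hV
  refine ⟨∑ μ, sV μ f z * (((lev L k : ℕ) : ℂ) * ((if z' = z + Pi.single μ 1 ∧ g = f then 1 else 0) - (if z' = z ∧ g = f then 1 else 0))), ?_⟩
  have e : ∀ t, Pmodel L (cubic d (side t)) (V t) k (castT (cubic d (lev L k * side t)) z, f) (castT (cubic d (lev L k * side t)) z', g)
      = ∑ μ, V t k μ (castT (cubic d (lev L k * side t)) z, f)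
          * fdiff (cubic d (lev L k * side t)) ((lev L k : ℕ) : ℂ) μ (castT (cubic d (lev L k * side t)) z, f) (castT (cubic d (lev L k * side t)) z', g) := by
    intro t
    unfold Pmodel firstOrder
    rw [Matrix.sum_apply]
    refine Finset.sum_congr rfl fun μ _ => ?_
    rw [Matrix.diagonal_mul]
  simp only [e]
  exact tendsto_finsetSum _ fun μ _ => (hsV μ f z).mul (tendsto_fdiff_pair (d := d) hside' ((lev L k : ℕ) : ℂ) μ f g z z')

/-- **an eventually constant reading converges** [folklore]: a sequence that equals `v` for all large `t` tends to `v`. -/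
theorem tendsto_of_eventually_eq {u : ℕ → ℂ} {v : ℂ} (h : ∀ᶠ t in atTop, u t = v) : Tendsto u atTop (𝓝 v) :=
  tendsto_const_nhds.congr' (h.mono fun _ ht => ht.symm)

omit [NeZero L] [∀ t, NeZero (side t)] in
/-- **EL₁ of an eventually-pulled-back family** [folklore]: if at every level, direction, component and integer point the reading `V_t k μ (ẑ_t, f)` is eventually the value
`v k μ z f` of ONE `ℤ^d` datum, the family has EL₁ (with limits `v`). -/
theorem tendsto_background_of_eventually_pullback (V : (t : ℕ) → (k : ℕ) → Fin d → (idx L (cubic d (side t)) k → ℂ)) (v : ℕ → Fin d → (Fin d → ℤ) → Fin d → ℂ)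
    (hpull : ∀ k (μ f : Fin d) (z : Fin d → ℤ), ∀ᶠ t in atTop, V t k μ (castT (cubic d (lev L k * side t)) z, f) = v k μ z f)
    (k : ℕ) (μ f : Fin d) (z : Fin d → ℤ) :
    ∃ s : ℂ, Tendsto (fun t => V t k μ (castT (cubic d (lev L k * side t)) z, f)) atTop (𝓝 s) :=
  ⟨v k μ z f, tendsto_of_eventually_eq (hpull k μ f z)⟩

end AnyVolume

/-! ## §2 PART 147's END modulo EL₁ of the background only -/

variable (a : ℝ) (ha : 0 < a)

/-- **`conv_effIns_of_tendsto_background` — THE u-DERIVATIVE SECTOR ON `ℤ^d` MODULO ONLY THE BACKGROUND's POINTWISE LIMIT** [our proof] (`d ≥ 3`, `L ≥ 2`, `a > 0`, `μ ≠ ν`, along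
the even cubic volumes `side t = 2(t+1)`): for a volume-indexed family of backgrounds `V_t` with `LipschitzBackground L (cubic d (2(t+1))) (V t) α β` (constants uniform in the volume)
whose readings at every fixed fine integer point converge (`∀ k μ f z, ∃ s, V_t k μ (ẑ_t, f) → s` — DISPLAYED; the background's infinite-volume limit in its weakest form), the tower
`c_k⁻¹·[L^{dk}Q_k(𝒢^{(k)}P(V_t)𝒢^{(k)})Q_kᴴ]·c_k⁻¹` (PART 128's `Σ̇_k` up to sign) has limit kernels `Π_k` (`IsInfiniteVolumeLimit`), `UniformDecay Π μ ν B (κ∕d)`,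
`StepRate Π μ ν B′ (κ∕d) (√(L⁻¹))`, `KernelInputs d Π`, and `∀ k, |secondMoment (Π k) μ ν − secondMoment (limKernelOf Π) μ ν| ≤ β′_d(B′∕(1−√(L⁻¹)), κ∕d)·(√(L⁻¹))^k` — PART 147 with its EL₂
input supplied by §1. [cite: Balaban1987RG1, (1.21)–(1.22) p.264 (shapes)] -/
theorem conv_effIns_of_tendsto_background (hL : 2 ≤ L) (hd : 3 ≤ d) {μ ν : Fin d} (hne : μ ≠ ν) {α β : ℝ}
    {V : (t : ℕ) → (k : ℕ) → Fin d → (idx L (cubic d (evenPeriod t)) k → ℂ)} (hV : ∀ t, LipschitzBackground L (cubic d (evenPeriod t)) (V t) α β)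
    (hV1 : ∀ k (μ f : Fin d) (z : Fin d → ℤ), ∃ s : ℂ, Tendsto (fun t => V t k μ (castT (cubic d (lev L k * evenPeriod t)) z, f)) atTop (𝓝 s)) :
    ∃ κ B B' : ℝ, 0 < κ ∧ 0 ≤ B ∧ 0 ≤ B' ∧ ∃ Pinf : ℕ → B12Beta.Kernel d,
      (∀ k, IsInfiniteVolumeLimit evenPeriod
        (fun t μ' ν' (z : Site d (evenPeriod t)) => (((unitCovB L (cubic d (evenPeriod t)) a ha k)⁻¹
            * avgTow (QBlev L (cubic d (evenPeriod t))) ((L : ℝ) ^ d)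
                (fun k' => calGlev L (cubic d (evenPeriod t)) a ha k' * Pmodel L (cubic d (evenPeriod t)) (V t) k' * calGlev L (cubic d (evenPeriod t)) a ha k') k
            * (unitCovB L (cubic d (evenPeriod t)) a ha k)⁻¹)
          ((unitIdx L (cubic d (evenPeriod t))).symm (z, μ')) ((unitIdx L (cubic d (evenPeriod t))).symm (0, ν'))).re) (Pinf k)) ∧
      Beta.LimitRate.UniformDecay Pinf μ ν B (κ / d) ∧ StepRate Pinf μ ν B' (κ / d) (Real.sqrt ((L : ℝ)⁻¹)) ∧
      (∃ K : KernelInputs d Pinf, K.θ = Real.sqrt ((L : ℝ)⁻¹) ∧ K.c₀ = betaPrime510 d (B' / (1 - Real.sqrt ((L : ℝ)⁻¹))) (κ / d) ∧ K.Pinf = limKernelOf Pinf ∧ K.μ = μ ∧ K.ν = ν) ∧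
      (∀ k, |B12Beta.secondMoment (Pinf k) μ ν - B12Beta.secondMoment (limKernelOf Pinf) μ ν|
          ≤ betaPrime510 d (B' / (1 - Real.sqrt ((L : ℝ)⁻¹))) (κ / d) * Real.sqrt ((L : ℝ)⁻¹) ^ k) :=
  conv_effIns_of_background L a ha hL hd hne hV fun k f g z z' => tendsto_Pmodel_pair_of_tendsto L tendsto_evenPeriod k V (hV1 k) f g z z'

/-! ## §3 Eventually-pulled-back families: the END with no limit hypothesis -/

/-- **`conv_effIns_of_eventually_pullback` — THE u-DERIVATIVE SECTOR ON `ℤ^d` FOR THE SAMPLES OF ONE `ℤ^d` BACKGROUND** [our proof] (`d ≥ 3`, `L ≥ 2`, `a > 0`, `μ ≠ ν`, even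
cubic volumes): for a volume-indexed family of Lipschitz backgrounds (`α, β` uniform in the volume) whose reading at each fixed level, direction, component and fine integer point is, for
all large `t`, the value `v k μ z f` of ONE datum `v` on `ℤ^d` (so: ANY behaviour on small volumes and near the seam is allowed, only the volume-uniform Lipschitz letters are kept),
PART 147's END holds with NO limit hypothesis: limit kernels, `UniformDecay`, `StepRate (√(L⁻¹))`, `KernelInputs`, `|secondMoment (Π k) − secondMoment Π_∞| ≤ c₀(√(L⁻¹))^k`.
[cite: Balaban1987RG1, (1.21)–(1.22) p.264 (shapes)] -/
theorem conv_effIns_of_eventually_pullback (hL : 2 ≤ L) (hd : 3 ≤ d) {μ ν : Fin d} (hne : μ ≠ ν) {α β : ℝ}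
    {V : (t : ℕ) → (k : ℕ) → Fin d → (idx L (cubic d (evenPeriod t)) k → ℂ)} (hV : ∀ t, LipschitzBackground L (cubic d (evenPeriod t)) (V t) α β)
    (v : ℕ → Fin d → (Fin d → ℤ) → Fin d → ℂ)
    (hpull : ∀ k (μ f : Fin d) (z : Fin d → ℤ), ∀ᶠ t in atTop, V t k μ (castT (cubic d (lev L k * evenPeriod t)) z, f) = v k μ z f) :
    ∃ κ B B' : ℝ, 0 < κ ∧ 0 ≤ B ∧ 0 ≤ B' ∧ ∃ Pinf : ℕ → B12Beta.Kernel d,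
      (∀ k, IsInfiniteVolumeLimit evenPeriod
        (fun t μ' ν' (z : Site d (evenPeriod t)) => (((unitCovB L (cubic d (evenPeriod t)) a ha k)⁻¹
            * avgTow (QBlev L (cubic d (evenPeriod t))) ((L : ℝ) ^ d)
                (fun k' => calGlev L (cubic d (evenPeriod t)) a ha k' * Pmodel L (cubic d (evenPeriod t)) (V t) k' * calGlev L (cubic d (evenPeriod t)) a ha k') k
            * (unitCovB L (cubic d (evenPeriod t)) a ha k)⁻¹)
          ((unitIdx L (cubic d (evenPeriod t))).symm (z, μ')) ((unitIdx L (cubic d (evenPeriod t))).symm (0, ν'))).re) (Pinf k)) ∧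
      Beta.LimitRate.UniformDecay Pinf μ ν B (κ / d) ∧ StepRate Pinf μ ν B' (κ / d) (Real.sqrt ((L : ℝ)⁻¹)) ∧
      (∃ K : KernelInputs d Pinf, K.θ = Real.sqrt ((L : ℝ)⁻¹) ∧ K.c₀ = betaPrime510 d (B' / (1 - Real.sqrt ((L : ℝ)⁻¹))) (κ / d) ∧ K.Pinf = limKernelOf Pinf ∧ K.μ = μ ∧ K.ν = ν) ∧
      (∀ k, |B12Beta.secondMoment (Pinf k) μ ν - B12Beta.secondMoment (limKernelOf Pinf) μ ν|
          ≤ betaPrime510 d (B' / (1 - Real.sqrt ((L : ℝ)⁻¹))) (κ / d) * Real.sqrt ((L : ℝ)⁻¹) ^ k) :=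
  conv_effIns_of_tendsto_background L a ha hL hd hne hV (tendsto_background_of_eventually_pullback L V v hpull)

end Summit.QuantumFields.BalabanUV.Beta.GAN24.BackgroundVolumeLimit

end
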